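import Mathlib
import Summits.NavierStokesRegularity.FluidComputer.TransportGalerkinBilinearLoss
import Summits.NavierStokesRegularity.FluidComputer.TransportGalerkinLerayDefs
import Summits.NavierStokesRegularity.FluidComputer.ConvectiveProductLawBooking
import Literature.Analysis.FluidPDE.TorusABCFlow
import HarnessLib

/-!
# The transport Galerkin model instantiated for the ABC host: Leray family, coordinate functionals, host data (instab g17, cell `ns-blowup`, 2026-08-27)

HONEST FRAMING (human ruling D-0035): nothing here is a claim about Navier–Stokes blow-up.
WHAT THIS IS NOT: not NS evidence — the abstract parameters of the (β2) chain
(`TransportGalerkinDefs … TransportGalerkinBilinearLoss`) DISCHARGED for the forced-ABC model on 𝕋³: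
`V = ℂ³` (`EuclideanSpace ℂ (Fin 3)`), `π_j = EuclideanSpace.proj j` (norm `≤ 1`),
`P = lerayCLM` (self-adjoint contractions, `isSelfAdjoint_lerayCLM` / `norm_lerayCLM_le`),
`Uv = 𝓕(abcFlow A B C)` (finitely supported ⇒ rapidly decreasing; real and divergence-free through the
coordinate functionals: `Torus.isConjSymm_abcCoeff`, `Torus.isTransversal_abcCoeff`), and
`σ² < ∞` on `ℤ³` (`ConvectiveProductLawBooking.tsum_sobolevWeight_neg_two_sq_lt_top`). Result:
`galerkinSetting_abc` and the KEEP/KILL sentences `half_prediction_abc` / `decay_two_abc` whose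
hypotheses are ONLY: `ν ≥ 0`, the box radii (`ρ ≥ 0`, `∑⟨l⟩ρ_l < ∞`, `∑⟨k⟩⁴ρ_k² < ∞`), RESIDENCE
(β3), the certificate objects (`G₁, G₂, G` + the three inequalities + tail inequality + `μ`) and
the eigen / seed data. Mathlib + the tree files cited; no new definitions.
-/

noncomputable section

namespace Summit.NavierStokesRegularity.FluidComputer.TransportGalerkinAbc

open Set Filter Topology Finset RCLike
open Literature.Analysis.FunctionSpaces Literature.Analysis.FunctionSpaces.Lattice
open Literature.Analysis.FunctionSpaces.Torus Literature.Analysis.ODE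
open Literature.Analysis.FluidPDE Literature.Analysis.FluidPDE.Torus UnitAddTorus
open Summit.NavierStokesRegularity.FluidComputer.TransportGalerkin
open Summit.NavierStokesRegularity.FluidComputer.TransportGalerkinContinuity
open Summit.NavierStokesRegularity.FluidComputer.TransportGalerkinBilinearLoss
open Summit.NavierStokesRegularity.FluidComputer.ConvectiveProductLawBooking
open scoped ENNReal NNReal ComplexConjugate InnerProductSpace

/-! ## §1 The Leray family: self-adjoint contractions -/

section Leray

variable {d : Type*} [Fintype d]

/-- **The Leray multiplier is symmetric**: `⟪Π_k w, v⟫ = ⟪w, Π_k v⟫` (both equal `⟪Π_k w, Π_k v⟫`,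
since `Π_k w ⊥ k`). -/
theorem inner_leraySym_comm (k : d → ℤ) (w v : EuclideanSpace ℂ d) :
    ⟪leraySym k w, v⟫_ℂ = ⟪w, leraySym k v⟫_ℂ := by
  have h1 : ⟪leraySym k w, v⟫_ℂ = ⟪leraySym k w, leraySym k v⟫_ℂ := by
    conv_lhs => rw [show v = leraySym k v + ((∑ i, (k i : ℂ) * v i) /
      ((freqNormSq k : ℝ) : ℂ)) • freqVec k by rw [leraySym_def, sub_add_cancel]]
    rw [inner_add_right, inner_smul_right, inner_freqVec_right, sum_mul_leraySym_apply, map_zero,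
      mul_zero, add_zero]
  have h2 : ⟪w, leraySym k v⟫_ℂ = ⟪leraySym k w, leraySym k v⟫_ℂ := by
    conv_lhs => rw [show w = leraySym k w + ((∑ i, (k i : ℂ) * w i) /
      ((freqNormSq k : ℝ) : ℂ)) • freqVec k by rw [leraySym_def, sub_add_cancel]]
    rw [inner_add_left, inner_smul_left, inner_freqVec_left, sum_mul_leraySym_apply, mul_zero, add_zero]
  rw [h1, h2]

/-- **`lerayCLM k` is self-adjoint.** -/
theorem isSelfAdjoint_lerayCLM (k : d → ℤ) : IsSelfAdjoint (lerayCLM k) := by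
  rw [ContinuousLinearMap.isSelfAdjoint_iff_isSymmetric]
  intro w v
  by_cases hk : k = 0
  · subst hk
    simp [lerayCLM_zero]
  · simp only [ContinuousLinearMap.coe_coe, lerayCLM_apply_of_ne_zero hk]
    exact inner_leraySym_comm k w v

/-- **`lerayCLM k` is a contraction.** -/
theorem norm_lerayCLM_le (k : d → ℤ) : ‖lerayCLM k‖ ≤ 1 := by
  refine ContinuousLinearMap.opNorm_le_bound _ zero_le_one fun c => ?_
  rw [one_mul]
  by_cases hk : k = 0
  · subst hk
    rw [lerayCLM_zero]
    simp
  · rw [lerayCLM_apply_of_ne_zero hk]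
    exact norm_leraySym_le k c

/-- **The coordinate functionals have norm `≤ 1`.** -/
theorem norm_proj_le (j : d) : ‖(EuclideanSpace.proj j : EuclideanSpace ℂ d →L[ℂ] ℂ)‖ ≤ 1 := by
  refine ContinuousLinearMap.opNorm_le_bound _ zero_le_one fun v => ?_
  rw [one_mul]
  exact PiLp.norm_apply_le v j

end Leray

/-! ## §2 The ABC host data -/

section Host

/-- The Fourier family of the ABC flow is the truncation of `abcCoeff` to the shell `{±eⱼ}`. -/
theorem abcHost_eq_trunc (A B C : ℝ) :
    mFourierCoeff (EuclideanSpace.complexify ∘ Torus.abcFlow A B C) = trunc Torus.abcFreq (Torus.abcCoeff A B C) := by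
  funext k
  rw [Torus.mFourierCoeff_abcFlow, trunc_apply]

/-- **The ABC host is rapidly decreasing** (finitely supported). -/
theorem rapidDecay_abcHost (A B C : ℝ) :
    RapidDecay (mFourierCoeff (EuclideanSpace.complexify ∘ Torus.abcFlow A B C)) := by
  rw [abcHost_eq_trunc]; exact rapidDecay_trunc _ _

/-- **The ABC host is real through the coordinate functionals**: `û(−p)_j = conj û(p)_j`. -/
theorem abcHost_real (A B C : ℝ) (j : Fin 3) (p : Fin 3 → ℤ) :
    (EuclideanSpace.proj j : EuclideanSpace ℂ (Fin 3) →L[ℂ] ℂ)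
        (mFourierCoeff (EuclideanSpace.complexify ∘ Torus.abcFlow A B C) (-p)) =
      conj ((EuclideanSpace.proj j : EuclideanSpace ℂ (Fin 3) →L[ℂ] ℂ)
        (mFourierCoeff (EuclideanSpace.complexify ∘ Torus.abcFlow A B C) p)) := by
  rw [Torus.mFourierCoeff_abcFlow, Torus.mFourierCoeff_abcFlow]
  by_cases hp : p ∈ Torus.abcFreq
  · rw [if_pos (Torus.neg_mem_abcFreq p hp), if_pos hp, Torus.isConjSymm_abcCoeff A B C p]
    rfl
  · have hnp : -p ∉ Torus.abcFreq := fun h => hp (by simpa using Torus.neg_mem_abcFreq (-p) h)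
    rw [if_neg hnp, if_neg hp, map_zero, map_zero]

/-- **The ABC host is divergence-free through the coordinate functionals**:
`∑_j ∂_j (û_j) = 0` on the lattice. -/
theorem abcHost_div (A B C : ℝ) :
    ∑ j, freqDeriv j (fun p => (EuclideanSpace.proj j : EuclideanSpace ℂ (Fin 3) →L[ℂ] ℂ)
      (mFourierCoeff (EuclideanSpace.complexify ∘ Torus.abcFlow A B C) p)) = 0 := by
  funext p
  rw [Finset.sum_apply, Pi.zero_apply]
  simp only [freqDeriv_apply, smul_eq_mul, Torus.mFourierCoeff_abcFlow]
  by_cases hp : p ∈ Torus.abcFreq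
  · simp only [if_pos hp]
    have ht := Torus.isTransversal_abcCoeff A B C p hp
    calc ∑ j, 2 * (Real.pi : ℂ) * Complex.I * ((p j : ℤ) : ℂ) *
          (EuclideanSpace.proj j : EuclideanSpace ℂ (Fin 3) →L[ℂ] ℂ) (Torus.abcCoeff A B C p)
        = 2 * (Real.pi : ℂ) * Complex.I * ∑ j, ((p j : ℤ) : ℂ) * Torus.abcCoeff A B C p j := by
          rw [Finset.mul_sum]
          exact Finset.sum_congr rfl fun j _ => by rw [show (EuclideanSpace.proj j :
            EuclideanSpace ℂ (Fin 3) →L[ℂ] ℂ) (Torus.abcCoeff A B C p) = Torus.abcCoeff A B C p j from rfl]; ring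
      _ = 0 := by rw [ht, mul_zero]
  · simp only [if_neg hp, map_zero, mul_zero, Finset.sum_const_zero]

end Host

/-! ## §3 The setting and the KEEP/KILL sentences for the forced-ABC model -/

section Abc

variable {ρ : (Fin 3 → ℤ) → ℝ} {ν : ℝ}

/-- **The Galerkin convergence setting of the forced-ABC perturbation model** (`V = ℂ³`,
`π = proj`, `P = lerayCLM`, `Uv = 𝓕(abcFlow A B C)`): from `ν ≥ 0`, the radii, and RESIDENCE. -/
theorem galerkinSetting_abc (A B C : ℝ) (hν : 0 ≤ ν)
    (hρ0 : ∀ k, 0 ≤ ρ k) (hρ1 : Summable fun k => sobolevWeight 1 k * ρ k)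
    (hρ2 : Summable fun k => (sobolevWeight 2 k * ρ k) ^ 2)
    {Z : Set (lp (fun _ : (Fin 3 → ℤ) => EuclideanSpace ℂ (Fin 3)) 2)} {T : ℝ}
    {u : ℕ → lp (fun _ : (Fin 3 → ℤ) => EuclideanSpace ℂ (Fin 3)) 2 → ℝ → lp (fun _ : (Fin 3 → ℤ) => EuclideanSpace ℂ (Fin 3)) 2}
    (hT : 0 ≤ T) (hZ : Z ⊆ box ρ (fun j => (EuclideanSpace.proj j : EuclideanSpace ℂ (Fin 3) →L[ℂ] ℂ)) lerayCLM)
    (sol_continuousOn : ∀ n, ∀ x ∈ Z, ContinuousOn (u n x) (Icc 0 T))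
    (sol_init : ∀ n, ∀ x ∈ Z, u n x 0 = cubeProj n x)
    (sol_hasDerivAt : ∀ n, ∀ x ∈ Z, ∀ t ∈ Ioo 0 T,
      HasDerivAt (u n x) (cubeProj n (nsField ν (mFourierCoeff (EuclideanSpace.complexify ∘ Torus.abcFlow A B C)) (fun j => (EuclideanSpace.proj j : EuclideanSpace ℂ (Fin 3) →L[ℂ] ℂ)) lerayCLM (u n x t))) t)
    (sol_mem : ∀ n, ∀ x ∈ Z, ∀ t ∈ Icc 0 T, u n x t ∈ box ρ (fun j => (EuclideanSpace.proj j : EuclideanSpace ℂ (Fin 3) →L[ℂ] ℂ)) lerayCLM)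
    (sol_proj : ∀ n, ∀ x ∈ Z, ∀ t ∈ Icc 0 T, cubeProj n (u n x t) = u n x t) :
    GalerkinConvergenceSetting (fun n => (cubeProj n :
        lp (fun _ : (Fin 3 → ℤ) => EuclideanSpace ℂ (Fin 3)) 2 →L[ℝ] lp (fun _ : (Fin 3 → ℤ) => EuclideanSpace ℂ (Fin 3)) 2))
      (nsField ν (mFourierCoeff (EuclideanSpace.complexify ∘ Torus.abcFlow A B C)) (fun j => (EuclideanSpace.proj j : EuclideanSpace ℂ (Fin 3) →L[ℂ] ℂ)) lerayCLM) (box ρ (fun j => (EuclideanSpace.proj j : EuclideanSpace ℂ (Fin 3) →L[ℂ] ℂ)) lerayCLM) Z T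
      ((6 * Real.pi * (∑ j, (symbNorm 2 (scal (fun p => (fun j => (EuclideanSpace.proj j : EuclideanSpace ℂ (Fin 3) →L[ℂ] ℂ)) j ((mFourierCoeff (EuclideanSpace.complexify ∘ Torus.abcFlow A B C)) p)) : (Fin 3 → ℤ) → (EuclideanSpace ℂ (Fin 3) →L[ℂ] EuclideanSpace ℂ (Fin 3)))).toReal)
        + 2 * ((Fintype.card (Fin 3) : ℝ) * (2 * Real.pi)) *
          (∑' l, ENNReal.ofReal (sobolevWeight 3 l) * ‖(mFourierCoeff (EuclideanSpace.complexify ∘ Torus.abcFlow A B C)) l‖ₑ).toReal)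
        + 10 * Real.pi * (Fintype.card (Fin 3) : ℝ) * (∑' l, sobolevWeight 1 l * ρ l)) u :=
  galerkinSetting_nsField hν (rapidDecay_abcHost A B C) (abcHost_real A B C) (abcHost_div A B C)
    norm_proj_le isSelfAdjoint_lerayCLM norm_lerayCLM_le hρ0 hρ1 hρ2 hT hZ sol_continuousOn sol_init
    sol_hasDerivAt sol_mem sol_proj

/-- **KEEP for the forced-ABC model** — hypotheses: `ν ≥ 0`, radii, RESIDENCE (β3), the
certificate objects `G₁, G₂, G` with THE CERTIFICATE, and the eigen / seed data (everything else
— (C1), (C2), the level generators, the diagonal weight, the (B) law, `σ² < ∞` — is discharged). -/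
theorem half_prediction_abc (A B C : ℝ) (hν : 0 ≤ ν)
    (hρ0 : ∀ k, 0 ≤ ρ k) (hρ1 : Summable fun k => sobolevWeight 1 k * ρ k)
    (hρ2 : Summable fun k => (sobolevWeight 2 k * ρ k) ^ 2)
    {Z : Set (lp (fun _ : (Fin 3 → ℤ) => EuclideanSpace ℂ (Fin 3)) 2)} {T : ℝ}
    {u : ℕ → lp (fun _ : (Fin 3 → ℤ) => EuclideanSpace ℂ (Fin 3)) 2 → ℝ → lp (fun _ : (Fin 3 → ℤ) => EuclideanSpace ℂ (Fin 3)) 2}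
    (hT : 0 ≤ T) (hZ : Z ⊆ box ρ (fun j => (EuclideanSpace.proj j : EuclideanSpace ℂ (Fin 3) →L[ℂ] ℂ)) lerayCLM)
    (sol_continuousOn : ∀ n, ∀ x ∈ Z, ContinuousOn (u n x) (Icc 0 T))
    (sol_init : ∀ n, ∀ x ∈ Z, u n x 0 = cubeProj n x)
    (sol_hasDerivAt : ∀ n, ∀ x ∈ Z, ∀ t ∈ Ioo 0 T,
      HasDerivAt (u n x) (cubeProj n (nsField ν (mFourierCoeff (EuclideanSpace.complexify ∘ Torus.abcFlow A B C)) (fun j => (EuclideanSpace.proj j : EuclideanSpace ℂ (Fin 3) →L[ℂ] ℂ)) lerayCLM (u n x t))) t)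
    (sol_mem : ∀ n, ∀ x ∈ Z, ∀ t ∈ Icc 0 T, u n x t ∈ box ρ (fun j => (EuclideanSpace.proj j : EuclideanSpace ℂ (Fin 3) →L[ℂ] ℂ)) lerayCLM)
    (sol_proj : ∀ n, ∀ x ∈ Z, ∀ t ∈ Icc 0 T, cubeProj n (u n x t) = u n x t)
    {μ : ℝ}
    {G₁ G₂ G : lp (fun _ : (Fin 3 → ℤ) => EuclideanSpace ℂ (Fin 3)) 2 →L[ℝ] lp (fun _ : (Fin 3 → ℤ) => EuclideanSpace ℂ (Fin 3)) 2}
    (hG₁ : ∀ x y : lp (fun _ : (Fin 3 → ℤ) => EuclideanSpace ℂ (Fin 3)) 2, ⟪G₁ x, y⟫_ℂ = ⟪x, G₁ y⟫_ℂ)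
    (hG₂ : ∀ x y : lp (fun _ : (Fin 3 → ℤ) => EuclideanSpace ℂ (Fin 3)) 2, ⟪G₂ x, y⟫_ℂ = ⟪x, G₂ y⟫_ℂ)
    (hG : ∀ x y : lp (fun _ : (Fin 3 → ℤ) => EuclideanSpace ℂ (Fin 3)) 2, ⟪G x, y⟫_ℂ = ⟪x, G y⟫_ℂ)
    (hG₁P : ∀ n, ∀ w z : lp (fun _ : (Fin 3 → ℤ) => EuclideanSpace ℂ (Fin 3)) 2, ⟪G₁ w, cubeProj n z⟫_ℂ = ⟪G₁ (cubeProj n w), z⟫_ℂ)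
    (hG₂P : ∀ n, ∀ w z : lp (fun _ : (Fin 3 → ℤ) => EuclideanSpace ℂ (Fin 3)) 2, ⟪G₂ w, cubeProj n z⟫_ℂ = ⟪G₂ (cubeProj n w), z⟫_ℂ)
    (hGP : ∀ n, ∀ w z : lp (fun _ : (Fin 3 → ℤ) => EuclideanSpace ℂ (Fin 3)) 2, ⟪G w, cubeProj n z⟫_ℂ = ⟪G (cubeProj n w), z⟫_ℂ)
    (hG₁pos : ∀ x : lp (fun _ : (Fin 3 → ℤ) => EuclideanSpace ℂ (Fin 3)) 2, 0 ≤ re ⟪G₁ x, x⟫_ℂ) {ω c m₂ M₁ : ℝ} (hc : 0 < c)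
    (hm₂ : 0 < m₂) (hM₁ : 0 ≤ M₁)
    (hm₂' : ∀ x : lp (fun _ : (Fin 3 → ℤ) => EuclideanSpace ℂ (Fin 3)) 2, m₂ * ‖x‖ ^ 2 ≤ re ⟪G₂ x, x⟫_ℂ)
    (hM₁' : ∀ x : lp (fun _ : (Fin 3 → ℤ) => EuclideanSpace ℂ (Fin 3)) 2, re ⟪G₁ x, x⟫_ℂ ≤ M₁ * (eNormSq (-1) (⇑x)).toReal)
    {m M ω₁ : ℝ} (hm0 : 0 < m) (hm : ∀ x : lp (fun _ : (Fin 3 → ℤ) => EuclideanSpace ℂ (Fin 3)) 2, m * ‖x‖ ^ 2 ≤ re ⟪G x, x⟫_ℂ)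
    (hM : ∀ x : lp (fun _ : (Fin 3 → ℤ) => EuclideanSpace ℂ (Fin 3)) 2, re ⟪G x, x⟫_ℂ ≤ M * ‖x‖ ^ 2)
    (h₁ : ∀ n, ∀ w : lp (fun _ : (Fin 3 → ℤ) => EuclideanSpace ℂ (Fin 3)) 2,
      2 * re ⟪G₁ (cubeProj n w), linOp ν (mFourierCoeff (EuclideanSpace.complexify ∘ Torus.abcFlow A B C)) (fun j => (EuclideanSpace.proj j : EuclideanSpace ℂ (Fin 3) →L[ℂ] ℂ)) lerayCLM (cubeProj n w)⟫_ℂ + c * re ⟪G₂ (cubeProj n w), cubeProj n w⟫_ℂ ≤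
        2 * ω * re ⟪G₁ (cubeProj n w), cubeProj n w⟫_ℂ)
    (h₂ : ∀ n, ∀ w : lp (fun _ : (Fin 3 → ℤ) => EuclideanSpace ℂ (Fin 3)) 2,
      re ⟪G₂ (cubeProj n w), linOp ν (mFourierCoeff (EuclideanSpace.complexify ∘ Torus.abcFlow A B C)) (fun j => (EuclideanSpace.proj j : EuclideanSpace ℂ (Fin 3) →L[ℂ] ℂ)) lerayCLM (cubeProj n w)⟫_ℂ ≤ ω * re ⟪G₂ (cubeProj n w), cubeProj n w⟫_ℂ)
    (hL : ∀ n, ∀ w : lp (fun _ : (Fin 3 → ℤ) => EuclideanSpace ℂ (Fin 3)) 2,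
      re ⟪G (cubeProj n w), linOp ν (mFourierCoeff (EuclideanSpace.complexify ∘ Torus.abcFlow A B C)) (fun j => (EuclideanSpace.proj j : EuclideanSpace ℂ (Fin 3) →L[ℂ] ℂ)) lerayCLM (cubeProj n w)⟫_ℂ ≤ ω₁ * re ⟪G (cubeProj n w), cubeProj n w⟫_ℂ)
    (hμ₁ : μ ≤ ω₁) (hμ₂ : μ ≤ ω)
    (htail : ∀ n, ∀ q : lp (fun _ : (Fin 3 → ℤ) => EuclideanSpace ℂ (Fin 3)) 2, cubeProj n q = 0 →
      2 * μ * re ⟪G₁ q, q⟫_ℂ + c * re ⟪G₂ q, q⟫_ℂ ≤ 2 * ω * re ⟪G₁ q, q⟫_ℂ)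
    {v : lp (fun _ : (Fin 3 → ℤ) => EuclideanSpace ℂ (Fin 3)) 2} (hv1 : ‖v‖ = 1) {lam ε : ℝ} (hgap : ω < 2 * lam)
    (hlam : 0 ≤ lam) (hε : 0 < ε) (hx : ε • v ∈ Z)
    (hres : Tendsto (fun n => ‖cubeProj n (linOp ν (mFourierCoeff (EuclideanSpace.complexify ∘ Torus.abcFlow A B C)) (fun j => (EuclideanSpace.proj j : EuclideanSpace ℂ (Fin 3) →L[ℂ] ℂ)) lerayCLM (cubeProj n v)) - lam • cubeProj n v‖)
      atTop (𝓝 0))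
    {C' : ℝ}
    (hCC' : Real.sqrt (M₁ / (c * m₂)) * (2 * ((Fintype.card (Fin 3) : ℝ) * (2 * Real.pi)) *
        Real.sqrt ((∑' l : Fin 3 → ℤ, ENNReal.ofReal (sobolevWeight (-2) l ^ 2)).toReal)) * Real.sqrt (Real.pi / (2 * lam - ω)) < C')
    (hsmall : ∀ t ∈ Icc 0 T, C' * (3 / 2 : ℝ) ^ 2 * (ε * Real.exp (lam * t)) < 3 / 2 - 1)
    {w : ℝ → lp (fun _ : (Fin 3 → ℤ) => EuclideanSpace ℂ (Fin 3)) 2} (hw : ContinuousOn w (Icc 0 T)) (hw0 : w 0 = ε • v)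
    (hw' : ∀ t ∈ Ioo 0 T, HasDerivAt w (nsField ν (mFourierCoeff (EuclideanSpace.complexify ∘ Torus.abcFlow A B C)) (fun j => (EuclideanSpace.proj j : EuclideanSpace ℂ (Fin 3) →L[ℂ] ℂ)) lerayCLM (w t)) t) (hwW : ∀ t ∈ Icc 0 T, w t ∈ box ρ (fun j => (EuclideanSpace.proj j : EuclideanSpace ℂ (Fin 3) →L[ℂ] ℂ)) lerayCLM)
    {t : ℝ} (ht : t ∈ Icc 0 T) (hχ : ε * Real.exp (lam * t) ≤ 2 / (9 * C')) :
    ε * Real.exp (lam * t) / 2 ≤ ‖w t‖ :=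
  half_prediction_nsField'' hν (rapidDecay_abcHost A B C) (abcHost_real A B C) (abcHost_div A B C) norm_proj_le
    isSelfAdjoint_lerayCLM norm_lerayCLM_le hρ0 hρ1 hρ2 hT hZ sol_continuousOn sol_init sol_hasDerivAt sol_mem
    sol_proj (tsum_sobolevWeight_neg_two_sq_lt_top (Fintype.card_fin 3).le) hG₁ hG₂ hG hG₁P hG₂P hGP hG₁pos
    hc hm₂ hM₁ hm₂' hM₁' hm0 hm hM h₁ h₂ hL hμ₁ hμ₂ htail hv1 hgap hlam hε hx hres hCC' hsmall hw hw0 hw'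
    hwW ht hχ

/-- **KILL for the forced-ABC model**, same discharges. -/
theorem decay_two_abc (A B C : ℝ) (hν : 0 ≤ ν)
    (hρ0 : ∀ k, 0 ≤ ρ k) (hρ1 : Summable fun k => sobolevWeight 1 k * ρ k)
    (hρ2 : Summable fun k => (sobolevWeight 2 k * ρ k) ^ 2)
    {Z : Set (lp (fun _ : (Fin 3 → ℤ) => EuclideanSpace ℂ (Fin 3)) 2)} {T : ℝ}
    {u : ℕ → lp (fun _ : (Fin 3 → ℤ) => EuclideanSpace ℂ (Fin 3)) 2 → ℝ → lp (fun _ : (Fin 3 → ℤ) => EuclideanSpace ℂ (Fin 3)) 2}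
    (hT : 0 ≤ T) (hZ : Z ⊆ box ρ (fun j => (EuclideanSpace.proj j : EuclideanSpace ℂ (Fin 3) →L[ℂ] ℂ)) lerayCLM)
    (sol_continuousOn : ∀ n, ∀ x ∈ Z, ContinuousOn (u n x) (Icc 0 T))
    (sol_init : ∀ n, ∀ x ∈ Z, u n x 0 = cubeProj n x)
    (sol_hasDerivAt : ∀ n, ∀ x ∈ Z, ∀ t ∈ Ioo 0 T,
      HasDerivAt (u n x) (cubeProj n (nsField ν (mFourierCoeff (EuclideanSpace.complexify ∘ Torus.abcFlow A B C)) (fun j => (EuclideanSpace.proj j : EuclideanSpace ℂ (Fin 3) →L[ℂ] ℂ)) lerayCLM (u n x t))) t)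
    (sol_mem : ∀ n, ∀ x ∈ Z, ∀ t ∈ Icc 0 T, u n x t ∈ box ρ (fun j => (EuclideanSpace.proj j : EuclideanSpace ℂ (Fin 3) →L[ℂ] ℂ)) lerayCLM)
    (sol_proj : ∀ n, ∀ x ∈ Z, ∀ t ∈ Icc 0 T, cubeProj n (u n x t) = u n x t)
    {μ : ℝ}
    {G₁ G₂ G : lp (fun _ : (Fin 3 → ℤ) => EuclideanSpace ℂ (Fin 3)) 2 →L[ℝ] lp (fun _ : (Fin 3 → ℤ) => EuclideanSpace ℂ (Fin 3)) 2}
    (hG₁ : ∀ x y : lp (fun _ : (Fin 3 → ℤ) => EuclideanSpace ℂ (Fin 3)) 2, ⟪G₁ x, y⟫_ℂ = ⟪x, G₁ y⟫_ℂ)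
    (hG₂ : ∀ x y : lp (fun _ : (Fin 3 → ℤ) => EuclideanSpace ℂ (Fin 3)) 2, ⟪G₂ x, y⟫_ℂ = ⟪x, G₂ y⟫_ℂ)
    (hG : ∀ x y : lp (fun _ : (Fin 3 → ℤ) => EuclideanSpace ℂ (Fin 3)) 2, ⟪G x, y⟫_ℂ = ⟪x, G y⟫_ℂ)
    (hG₁P : ∀ n, ∀ w z : lp (fun _ : (Fin 3 → ℤ) => EuclideanSpace ℂ (Fin 3)) 2, ⟪G₁ w, cubeProj n z⟫_ℂ = ⟪G₁ (cubeProj n w), z⟫_ℂ)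
    (hG₂P : ∀ n, ∀ w z : lp (fun _ : (Fin 3 → ℤ) => EuclideanSpace ℂ (Fin 3)) 2, ⟪G₂ w, cubeProj n z⟫_ℂ = ⟪G₂ (cubeProj n w), z⟫_ℂ)
    (hGP : ∀ n, ∀ w z : lp (fun _ : (Fin 3 → ℤ) => EuclideanSpace ℂ (Fin 3)) 2, ⟪G w, cubeProj n z⟫_ℂ = ⟪G (cubeProj n w), z⟫_ℂ)
    (hG₁pos : ∀ x : lp (fun _ : (Fin 3 → ℤ) => EuclideanSpace ℂ (Fin 3)) 2, 0 ≤ re ⟪G₁ x, x⟫_ℂ) {ω c m₂ M₁ : ℝ} (hc : 0 < c)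
    (hm₂ : 0 < m₂) (hM₁ : 0 ≤ M₁)
    (hm₂' : ∀ x : lp (fun _ : (Fin 3 → ℤ) => EuclideanSpace ℂ (Fin 3)) 2, m₂ * ‖x‖ ^ 2 ≤ re ⟪G₂ x, x⟫_ℂ)
    (hM₁' : ∀ x : lp (fun _ : (Fin 3 → ℤ) => EuclideanSpace ℂ (Fin 3)) 2, re ⟪G₁ x, x⟫_ℂ ≤ M₁ * (eNormSq (-1) (⇑x)).toReal)
    {m M ω₁ : ℝ} (hm0 : 0 < m) (hm : ∀ x : lp (fun _ : (Fin 3 → ℤ) => EuclideanSpace ℂ (Fin 3)) 2, m * ‖x‖ ^ 2 ≤ re ⟪G x, x⟫_ℂ)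
    (hM : ∀ x : lp (fun _ : (Fin 3 → ℤ) => EuclideanSpace ℂ (Fin 3)) 2, re ⟪G x, x⟫_ℂ ≤ M * ‖x‖ ^ 2)
    (h₁ : ∀ n, ∀ w : lp (fun _ : (Fin 3 → ℤ) => EuclideanSpace ℂ (Fin 3)) 2,
      2 * re ⟪G₁ (cubeProj n w), linOp ν (mFourierCoeff (EuclideanSpace.complexify ∘ Torus.abcFlow A B C)) (fun j => (EuclideanSpace.proj j : EuclideanSpace ℂ (Fin 3) →L[ℂ] ℂ)) lerayCLM (cubeProj n w)⟫_ℂ + c * re ⟪G₂ (cubeProj n w), cubeProj n w⟫_ℂ ≤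
        2 * ω * re ⟪G₁ (cubeProj n w), cubeProj n w⟫_ℂ)
    (h₂ : ∀ n, ∀ w : lp (fun _ : (Fin 3 → ℤ) => EuclideanSpace ℂ (Fin 3)) 2,
      re ⟪G₂ (cubeProj n w), linOp ν (mFourierCoeff (EuclideanSpace.complexify ∘ Torus.abcFlow A B C)) (fun j => (EuclideanSpace.proj j : EuclideanSpace ℂ (Fin 3) →L[ℂ] ℂ)) lerayCLM (cubeProj n w)⟫_ℂ ≤ ω * re ⟪G₂ (cubeProj n w), cubeProj n w⟫_ℂ)
    (hL : ∀ n, ∀ w : lp (fun _ : (Fin 3 → ℤ) => EuclideanSpace ℂ (Fin 3)) 2,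
      re ⟪G (cubeProj n w), linOp ν (mFourierCoeff (EuclideanSpace.complexify ∘ Torus.abcFlow A B C)) (fun j => (EuclideanSpace.proj j : EuclideanSpace ℂ (Fin 3) →L[ℂ] ℂ)) lerayCLM (cubeProj n w)⟫_ℂ ≤ ω₁ * re ⟪G (cubeProj n w), cubeProj n w⟫_ℂ)
    (hμ₁ : μ ≤ ω₁) (hμ₂ : μ ≤ ω)
    (htail : ∀ n, ∀ q : lp (fun _ : (Fin 3 → ℤ) => EuclideanSpace ℂ (Fin 3)) 2, cubeProj n q = 0 →
      2 * μ * re ⟪G₁ q, q⟫_ℂ + c * re ⟪G₂ q, q⟫_ℂ ≤ 2 * ω * re ⟪G₁ q, q⟫_ℂ)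
    {lam : ℝ} (hgap : ω < 2 * lam) (hlam : lam ≤ 0) (hrate : ω₁ ≤ lam)
    {x : lp (fun _ : (Fin 3 → ℤ) => EuclideanSpace ℂ (Fin 3)) 2} (hxZ : x ∈ Z) {ε : ℝ} (hε : 0 < ε)
    (hseed : Real.sqrt (M / m) * ‖x‖ < ε)
    (hbasin : 4 * (Real.sqrt (M₁ / (c * m₂)) * (2 * ((Fintype.card (Fin 3) : ℝ) * (2 * Real.pi)) *
        Real.sqrt ((∑' l : Fin 3 → ℤ, ENNReal.ofReal (sobolevWeight (-2) l ^ 2)).toReal)) * Real.sqrt (Real.pi / (2 * lam - ω))) * ε < 1)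
    {w : ℝ → lp (fun _ : (Fin 3 → ℤ) => EuclideanSpace ℂ (Fin 3)) 2} (hw : ContinuousOn w (Icc 0 T)) (hw0 : w 0 = x)
    (hw' : ∀ t ∈ Ioo 0 T, HasDerivAt w (nsField ν (mFourierCoeff (EuclideanSpace.complexify ∘ Torus.abcFlow A B C)) (fun j => (EuclideanSpace.proj j : EuclideanSpace ℂ (Fin 3) →L[ℂ] ℂ)) lerayCLM (w t)) t)
    (hwW : ∀ t ∈ Icc 0 T, w t ∈ box ρ (fun j => (EuclideanSpace.proj j : EuclideanSpace ℂ (Fin 3) →L[ℂ] ℂ)) lerayCLM) :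
    ∀ t ∈ Icc 0 T, ‖w t‖ ≤ 2 * (ε * Real.exp (lam * t)) :=
  decay_two_nsField'' hν (rapidDecay_abcHost A B C) (abcHost_real A B C) (abcHost_div A B C) norm_proj_le
    isSelfAdjoint_lerayCLM norm_lerayCLM_le hρ0 hρ1 hρ2 hT hZ sol_continuousOn sol_init sol_hasDerivAt sol_mem
    sol_proj (tsum_sobolevWeight_neg_two_sq_lt_top (Fintype.card_fin 3).le) hG₁ hG₂ hG hG₁P hG₂P hGP hG₁pos
    hc hm₂ hM₁ hm₂' hM₁' hm0 hm hM h₁ h₂ hL hμ₁ hμ₂ htail hgap hlam hrate hxZ hε hseed hbasin hw hw0 hw' hwW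

end Abc

end Summit.NavierStokesRegularity.FluidComputer.TransportGalerkinAbc

end
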